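import Summits.QuantumFields.YangMills.Theorems.BalabanUVNodesK0BgProvisoOverRangeLinear
import Literature.MathematicalPhysics.QuantumFieldTheory.Balaban1983to89.Node00.Record12NumericsWindow
import Literature.MathematicalPhysics.QuantumFieldTheory.Balaban1983to89.Node00.Record12LiveSelector
import Literature.MathematicalPhysics.QuantumFieldTheory.Balaban1983to89.Node00.Record12NumericsFamily

/-!
# K0′ ∕ RECORD13 gate ROW P11 — the certificate AT THE WITNESS OF RECORD (part 5): at `θ₀ = theta12OfRecord F 2 ζ Rz Zt` and
# `θ₀ˡⁱᵛᵉ = theta12LiveOfRecord F 2 ζ Rz Zt` (and at the family's `θ₀ᶠᵃᵐ(ε₀)` ∕ `θ₀ᶠᵃᵐ,ˡⁱᵛᵉ(ε₀)`, every `ε₀`), `Provisos₁₂` (unranged `bg`)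
# is INCOMPATIBLE with every level-0 upper bound `β⁺ ≤ 165` of the merged β of record on `]0, ½]`

Cell `pub-ymgap`, seat `pub-ymgap-dag-n21-c` (g5), `--supports stmt-QuantumFields-19909 --as helper` (K0‴ lane; the ₁₂ item
stmt-QuantumFields-19902 it concerns is ASIDE since rev 16).  COUNT-NEUTRAL.  Answers referee-H g4 READ-71-73 (c) «WATCH-N: exhibit ONE
instance `(θ₁₂ˡⁱᵛᵉ, p, n, s)` of the six hypotheses of `not_provisos₁₂_of_window_smallRadius`, or say none».

THE ANSWER, LOCATED.  Of the six hypotheses of the linear certificate (part 4, `not_provisos₁₂_of_window_smallRadius_linear_general`)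
five are NUMERALS at the witness of record (`C₀ = A₀ = cR = εreg = M = 1`, `p₀ = 1`, `q₀ = 2`, `γ = ½`, `η₁ = 1∕L`, `L ≥ 13`) and
HOLD at `n = 1` for every window-staying one-step run: the room `4·α₀(g₁)·L⁻² < min(g₀·log g₀⁻², 1)` with
`α₀(g) = g·(log g⁻²)² = 4u²e^{−u} ≤ 16e⁻² < 16∕7` (`u = log g⁻¹`; `t ≤ e^{t−1}`) UNIFORMLY in `g₁ ∈ ]0, 1]`, against
`g₀·log g₀⁻² ≥ g₀·log 4` for `g₀ ≤ ½`.  The sixth, the WINDOW `hw : 0 < g₀, g₁ ≤ ½` of the generated history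
`gOfRecord₁₀ θ₀ p = genSeq β₁₀ g₀`, is (node00-def-K0a `Record12NumericsWindow.inInterval_one_gOfRecord₁₀_iff`) the ONE inequality
`βm₁(g₀) ≤ g₀⁻² − 4` on the LEVEL-0 MERGED β OF RECORD — an integral over the Stage-8 densities that no tree theorem evaluates or
bounds at the witness; K0a's own K1′-window face `window_theta12OfRecord_of_level0Upper` takes the level-0 bound
`hup : ∀ g ∈ ]0, ½], βm₁(g) ≤ β⁺` as a HYPOTHESIS and runs the EXPLICIT bare coupling `g₀ := (4 + max(β⁺,0))^{−1∕2}` one step inside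
`]0, ½]`.  So `¬ Record12Inhabited` (`∃ F, ∀ θ, …`) is NOT one `example` away — the booking «stmt-QuantumFields-19902 SUPERSEDED-BY-RE-KEY»
(not «refuted») is the accurate ledger state — but RELATIVE TO `hup` the instance exists: `(θ₀ or θ₀ˡⁱᵛᵉ, p = ⟨1, m, g₀⟩, n = 1,
s = 8∕(7L²))`, for every `β⁺ ≤ 165` (`⇔ g₀ ≥ 1∕13`, the only use of the bound).

WHAT IS PROVED (kernel; [folklore] numerics + bookkeeping; nothing of Bałaban asserted or refuted).
§1 `thirteen_le_L` (`Odd L ∧ 11 < L ⇒ 13 ≤ L`), `mul_log_inv_sq_sq_le` (`0 < g ≤ 1 ⇒ g·(log (g²)⁻¹)² ≤ 16·e⁻²`),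
`log_four_le_log_inv_sq` (`0 < g ≤ ½ ⇒ log 4 ≤ log (g²)⁻¹`), `one_div_thirteen_le_solveCoupling` (`b ≤ 165 ⇒ 1∕13 ≤ (4 + max(b,0))^{−1∕2}`);
the numerals `e⁻² < 1∕7`, `1 < log 4` are proved inline (they exist in the tree under `Literature.Barriers.RiemannHypothesis.exp_neg_two_lt` ∕
`Literature.NumberTheory.LFunctions.one_lt_log_four`, not imported into this closure).
§2 ★ `not_provisos₁₂_of_recordNumerals`: ANY `θ : Stage12Params F 2` carrying the record's numerals (`γ = ½`, `M = 1`, `cR = 1`, `εreg = A₀ = 1`,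
`p₀ = 1`, `C₀ = 1`, `q₀ = 2`) fails `Provisos₁₂` along any run with `K ≥ 1` whose generated history stays in `]0, ½]` up to step 1 with
`g₀ ≥ 1∕13` (part 4 at `n = 1`, `s = 8∕(7L²)`); `inInterval_half_stage12OfNumerics_of_level0Upper`: K0a's explicit run
`⟨1, m, (4 + max(β⁺,0))^{−1∕2}⟩` at a generic maker `stage12OfNumerics` with `γ = ½` (the `←` direction of K0a's `inInterval_one_stage12OfNumerics_iff`).
§3 ★ `not_provisos₁₂_theta12OfRecord_of_level0Upper`: at `θ₀`, K0a's `hup` with `β⁺ ≤ 165` ⇒ `¬ θ₀.Provisos₁₂ F 2`;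
★★ `not_provisos₁₂_theta12LiveOfRecord_of_level0Upper`: the same at `θ₀ˡⁱᵛᵉ` (histories, numerals and Stage-8 part are selector-blind,
`Stage12Params.gOfRecord₁₀_liveRepin`, `rfl`).  §4 ★ `not_provisos₁₂_theta12OfFamily_of_level0Upper` ∕ ★★ `…theta12LiveOfFamily…`: the same
at node00-def-K0a's re-pinned witness OF THE FAMILY `θ₀ᶠᵃᵐ(ε₀)` ∕ `θ₀ᶠᵃᵐ,ˡⁱᵛᵉ(ε₀)`, for EVERY threshold letter `ε₀` (`κ`, `ε₀` are not read).
All faces `rfl`: the four corollaries are ONE generic lemma instantiated.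

HONEST FRAMING (binding).  CONDITIONAL on `hup` exactly as K0a's ROW-W12 faces are; the constant `165` is a convenience (`g₀ ≥ 1∕13`),
print's `β₁` is `O(1)`.  It says: the Stage-12 TYPING «K0′ (unranged `bg`) ∧ the K1′ window conjunct» was jointly unsatisfiable AT ITS OWN
WITNESS under every sane level-0 β bound — a statement about the retired ₁₂ text, NOT about Bałaban's theorems and NOT about the Stage-13
record: there `Provisos₁₃.bg := BgProvisoΛ` is RANGED (node00-def-T v1.1 p488788) and part 3 (p489051) proves the ranged token PASSES this very
witness.  K0′∕K0‴ neither discharged nor refuted; counts unmoved (typed 28∕28 · discharged 5∕27); one finite `𝕋⁴` torus family at fixed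
`ε = L^{−K}`; not continuum ∕ OS ∕ mass gap ∕ Clay.  No `sorry`, no `def`, no `instance`, no `notation`; standard axioms.

DEPENDENCES (by name).  Part 4 `not_provisos₁₂_of_window_smallRadius_linear_general` (this lineage, p491268); node00-def-K0a
`inInterval_half_theta12OfRecord_of_level0Upper`, `inInterval_one_stage12OfNumerics_iff`, `solveCoupling_window_iff` (`Record12NumericsWindow`),
`theta12OfRecord` ∕ `stage12OfNumerics` ∕ `numerics7OfRecord₁₂` ∕ `lfConstsOfRecord₁₂` (`Record12Numerics`), `theta12LiveOfRecord`,
`Stage12Params.gOfRecord₁₀_liveRepin` (`Record12LiveSelector`), `theta12OfFamily` ∕ `theta12LiveOfFamily` ∕ `stage12NumericsOfFamily`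
(`Record12NumericsFamily`); `FlowStepRuns.solveCoupling ∕ genSeq_zero ∕ inv_sq_solveCoupling`; `epsOfRecord`, `p0Profile`, `Step.LFConsts.alpha0`,
`Params.eta`.  CITED, never restated.
-/

noncomputable section

open scoped Matrix.Norms.L2Operator

namespace Summit.QuantumFields.YangMills.Theorems.K0BgProvisoOverRange

open Literature.MathematicalPhysics.QuantumFieldTheory.Balaban1983to89
open Literature.MathematicalPhysics.QuantumFieldTheory.Balaban1983to89.Node00
open Literature.MathematicalPhysics.QuantumFieldTheory.Balaban1983to89.T4Continuum
open FlowStepRuns (solveCoupling genSeq genSeq_zero)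

/-! ## §1  The numerals of the witness -/

section Numerics

/-- `L ≥ 13` for every four-torus family (`L` odd, `L > 11`). [folklore] -/
theorem thirteen_le_L (F : T4Family) : (13 : ℝ) ≤ F.L := by
  obtain ⟨⟨j, hj⟩, _⟩ := F.hL
  have h11 := F.hL11
  have h13 : 13 ≤ F.L := by omega
  exact_mod_cast h13

/-- **The first-order radius profile is bounded on `]0, 1]`**: `g·(log (g²)⁻¹)² = 4u²e^{−u} ≤ 16e⁻²` (`u = log g⁻¹ ≥ 0`; from `t ≤ e^{t−1}` at
`t = u∕2`). [folklore] -/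
theorem mul_log_inv_sq_sq_le {g : ℝ} (hg : 0 < g) (hg1 : g ≤ 1) :
    g * (Real.log (g ^ 2)⁻¹) ^ 2 ≤ 16 * Real.exp (-2) := by
  set u : ℝ := -Real.log g with hu
  have hg_eq : g = Real.exp (-u) := by rw [hu, neg_neg, Real.exp_log hg]
  have hlog : Real.log (g ^ 2)⁻¹ = 2 * u := by
    rw [Real.log_inv, Real.log_pow, hu]; push_cast; ring
  have key : u / 2 ≤ Real.exp (u / 2 - 1) := by
    have h := Real.add_one_le_exp (u / 2 - 1); linarith
  have hu0 : 0 ≤ u / 2 := by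
    have : Real.log g ≤ 0 := Real.log_nonpos hg.le hg1
    rw [hu]; linarith
  have key2 : (u / 2) ^ 2 ≤ Real.exp (u - 2) := by
    have h := mul_le_mul key key hu0 (Real.exp_pos _).le
    rw [← Real.exp_add] at h
    have e : u / 2 - 1 + (u / 2 - 1) = u - 2 := by ring
    rw [e] at h
    nlinarith [h]
  rw [hlog, hg_eq]
  calc Real.exp (-u) * (2 * u) ^ 2 = 16 * ((u / 2) ^ 2 * Real.exp (-u)) := by ring
    _ ≤ 16 * (Real.exp (u - 2) * Real.exp (-u)) := by
        gcongr
    _ = 16 * Real.exp (-2) := by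
        rw [← Real.exp_add]; congr 1; congr 1; ring

/-- For `0 < g ≤ ½`: `log 4 ≤ log (g²)⁻¹`. [folklore] -/
theorem log_four_le_log_inv_sq {g : ℝ} (hg : 0 < g) (hg2 : g ≤ 1 / 2) : Real.log 4 ≤ Real.log (g ^ 2)⁻¹ := by
  apply Real.log_le_log (by norm_num)
  rw [le_inv_comm₀ (by norm_num) (by positivity)]
  nlinarith [hg, hg2]

/-- K0a's explicit bare coupling `g₀ = (4 + max(β⁺,0))^{−1∕2}` is at least `1∕13` when `β⁺ ≤ 165` (`4 + β⁺ ≤ 13²`). [folklore] -/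
theorem one_div_thirteen_le_solveCoupling {b : ℝ} (hb : b ≤ 165) : 1 / 13 ≤ solveCoupling (4 + max b 0) := by
  have hpos : 0 < 4 + max b 0 := by positivity
  rw [FlowStepRuns.solveCoupling, if_pos hpos]
  have hs : Real.sqrt (4 + max b 0) ≤ 13 := by
    rw [show (13 : ℝ) = Real.sqrt (13 ^ 2) by rw [Real.sqrt_sq (by norm_num)]]
    apply Real.sqrt_le_sqrt
    have : max b 0 ≤ 165 := max_le hb (by norm_num)
    linarith
  exact one_div_le_one_div_of_le (Real.sqrt_pos.2 hpos) hs

end Numerics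

/-! ## §2  The certificate at UNIT NUMERALS: any Stage-12 parameter with the record's numerals fails `Provisos₁₂` along a one-step window run with `g₀ ≥ 1∕13` -/

section UnitNumerals

variable {F : T4Family}

/-- **PART 4 AT THE RECORD's NUMERALS.**  For a Stage-12 parameter `θ` at `N = 2` carrying the numerals of record (`γ = ½`, `M = 1`, `cR = 1`,
`εreg = A₀ = 1`, `p₀ = 1`, `C₀ = 1`, `q₀ = 2`) and a run `p` (`K ≥ 1`) whose generated history stays in `]0, ½]` up to step `1` with `g₀ ≥ 1∕13`:
`¬ θ.Provisos₁₂`.  The room of part 4's linear certificate at `n = 1`, `s = 8∕(7L²)`: `α₀(g₁)·L⁻² ≤ 16e⁻²·L⁻² ≤ 2s` (§1, uniformly in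
`g₁ ∈ ]0, ½]`), `8s = 64∕(7L²) ≤ 64∕1183 < 1∕13 ≤ g₀·log (g₀²)⁻¹ = cR·ε₀(g₀)` (`log 4 > 1`), `8s < 1 = εreg`, `L ≥ 13`.
[cite: Balaban1988Convergent, (2.27)–(2.28) p.259, (2.4) p.255; Balaban1987RG1, (0.17)–(0.20) pp.255–256, (1.14) p.262 (bookkeeping + elementary numerics)] -/
theorem not_provisos₁₂_of_recordNumerals (θ : Stage12Params F 2) (hγ : θ.γ = 1 / 2) (hM : θ.τ9.M = 1) (hcR : θ.s2.cR = 1)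
    (hεreg : θ.ν.εreg = 1) (hA₀ : θ.ν.A₀ = 1) (hp₀ : θ.ν.p₀ = 1) (hC₀ : (lfOfRecord₁₂ F 2 θ).C₀ = 1) (hq₀ : (lfOfRecord₁₂ F 2 θ).q₀ = 2)
    (p : B12.RunParams) (hK : 1 ≤ p.K) (hw : Step.InInterval (1 / 2) 1 (gOfRecord₁₀ F 2 θ.toStage9Params p))
    (hg0 : 1 / 13 ≤ gOfRecord₁₀ F 2 θ.toStage9Params p 0) : ¬ θ.Provisos₁₂ F 2 := by
  set g : ℕ → ℝ := gOfRecord₁₀ F 2 θ.toStage9Params p with hg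
  have hw' : Step.InInterval θ.γ 1 g := by rw [hγ]; exact hw
  have h0 := hw 0 (Nat.zero_le _)
  have h1 := hw 1 le_rfl
  have hL := thirteen_le_L F
  have hL0 : (0 : ℝ) < F.L := by linarith
  have heta : (F.P p.K).eta 1 ^ 2 = 1 / (F.L : ℝ) ^ 2 := by
    simp [Params.eta, T4Family.P_L]
  refine not_provisos₁₂_of_window_smallRadius_linear_general (N := 2) le_rfl θ p (n := 1) le_rfl hK hw'
    (by rw [hM]) (8 / (7 * (F.L : ℝ) ^ 2)) (by positivity) ?_ ?_ ?_ ?_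
  · -- `s ≤ 1`
    rw [div_le_one (by positivity)]; nlinarith [hL]
  · -- `8s < cR·ε₀(g₀) = g₀·log (g₀²)⁻¹`
    show 8 * (8 / (7 * (F.L : ℝ) ^ 2)) < θ.s2.cR * (g 0 * (θ.ν.A₀ * (Real.log (g 0 ^ 2)⁻¹) ^ θ.ν.p₀))
    rw [hcR, hA₀, hp₀, pow_one, one_mul, one_mul]
    have hlog : Real.log 4 ≤ Real.log (g 0 ^ 2)⁻¹ := log_four_le_log_inv_sq h0.1 h0.2
    have h4 : (1 : ℝ) < Real.log 4 := by  -- `log 4 = 2 log 2 > 1.38` (tree: `Literature.NumberTheory.LFunctions.one_lt_log_four`)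
      have h := Real.log_two_gt_d9
      have e : Real.log 4 = 2 * Real.log 2 := by
        rw [show (4 : ℝ) = 2 ^ 2 by norm_num, Real.log_pow]; push_cast; ring
      rw [e]; linarith
    have hL2 : (169 : ℝ) ≤ (F.L : ℝ) ^ 2 := by nlinarith [hL]
    have hlhs : 8 * (8 / (7 * (F.L : ℝ) ^ 2)) ≤ 64 / 1183 := by
      rw [show 8 * (8 / (7 * (F.L : ℝ) ^ 2)) = 64 / (7 * (F.L : ℝ) ^ 2) by ring,
        div_le_div_iff₀ (by positivity) (by norm_num)]
      nlinarith [hL2]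
    have hrhs : (1 : ℝ) / 13 * 1 ≤ g 0 * Real.log (g 0 ^ 2)⁻¹ :=
      mul_le_mul hg0 (h4.le.trans hlog) (by norm_num) h0.1.le
    nlinarith [hlhs, hrhs]
  · -- `8s < εreg = 1`
    rw [hεreg, show 8 * (8 / (7 * (F.L : ℝ) ^ 2)) = 64 / (7 * (F.L : ℝ) ^ 2) by ring, div_lt_one (by positivity)]
    nlinarith [hL]
  · -- `α₀(g₁)·η₁² ≤ 2s`
    show g 1 * (lfOfRecord₁₂ F 2 θ).C₀ * (Real.log (g 1 ^ 2)⁻¹) ^ (lfOfRecord₁₂ F 2 θ).q₀ * (F.P p.K).eta 1 ^ 2 ≤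
      2 * (8 / (7 * (F.L : ℝ) ^ 2))
    rw [hC₀, hq₀, heta]
    have hα : g 1 * (Real.log (g 1 ^ 2)⁻¹) ^ 2 ≤ 16 * Real.exp (-2) :=
      mul_log_inv_sq_sq_le h1.1 (h1.2.trans (by norm_num))
    have he : Real.exp (-2) < 1 / 7 := by  -- `e² > 7.38` (tree: `Literature.Barriers.RiemannHypothesis.exp_neg_two_lt`)
      have h1 := Real.exp_one_gt_d9
      have h2 : (7 : ℝ) < Real.exp 2 := by
        have e : Real.exp 2 = Real.exp 1 * Real.exp 1 := by rw [← Real.exp_add]; norm_num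
        rw [e]; nlinarith [h1, Real.exp_pos 1]
      rw [Real.exp_neg, ← one_div]
      exact one_div_lt_one_div_of_lt (by norm_num) h2
    have hα' : g 1 * (Real.log (g 1 ^ 2)⁻¹) ^ 2 ≤ 16 / 7 := by nlinarith [hα, he]
    rw [mul_one, mul_one_div, div_le_iff₀ (by positivity)]
    have e : 2 * (8 / (7 * (F.L : ℝ) ^ 2)) * (F.L : ℝ) ^ 2 = 16 / 7 := by field_simp; ring
    rw [e]; exact hα'

/-- **K0a's explicit one-step run at a generic maker `stage12OfNumerics`** with `n.γ = ½`: under a level-0 upper bound `β⁺` of the merged β of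
`(n.ν, n.εbg)` on `]0, ½]`, the run `⟨1, m, (4 + max(β⁺,0))^{−1∕2}⟩` stays in `]0, ½]` up to step 1 (the `←` direction of node00-def-K0a's
`inInterval_one_stage12OfNumerics_iff`, instantiated). [cite: Balaban1987RG1, (0.17)–(0.20) pp.255–256 and p.264 (elementary consequence, level 0)] -/
theorem inInterval_half_stage12OfNumerics_of_level0Upper (n : Stage12Numerics) (hγn : n.γ = 1 / 2) (res : Residual₅ F 2)
    (ζ : ZetaOfRecord F 2 n.ν n.τ9.M) (Rz : (K : ℕ) → Sect2.Residual (F.P K) (MatA 2)) (Zt : (K : ℕ) → TkResidualW F 2 (FluctV 2) K)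
    {βup : ℝ}
    (hup : ∀ g : ℝ, 0 < g → g ≤ 1 / 2 →
      betaMerged F (mergedTermFamilyMatT F 2 (TcOfRecord F 2) (chiFixed7 F 2 n.ν) n.εbg)
        (suChartMap 2) (Pi.basisFun ℝ (Fin (suChartDim 2))) 0 (fun _ => g) ≤ βup) (m : ℕ) :
    Step.InInterval (1 / 2) 1 (gOfRecord₁₀ F 2 (stage12OfNumerics F 2 n res ζ Rz Zt).toStage9Params ⟨1, m, solveCoupling (4 + max βup 0)⟩) := by
  have hy : 0 < 4 + max βup 0 := by positivity
  have hwin : 0 < solveCoupling (4 + max βup 0) ∧ solveCoupling (4 + max βup 0) ≤ 1 / 2 := by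
    rw [solveCoupling_window_iff (by norm_num : (0 : ℝ) < 1 / 2)]
    have : (1 : ℝ) / (1 / 2) ^ 2 = 4 := by norm_num
    rw [this]; exact le_add_of_nonneg_right (le_max_right _ _)
  refine (inInterval_one_stage12OfNumerics_iff F 2 n res ζ Rz Zt (by norm_num : (0 : ℝ) < 1 / 2) (by rw [hγn]) m _).2 ⟨hwin, ?_⟩
  rw [FlowStepRuns.inv_sq_solveCoupling hy, show (1 : ℝ) / (1 / 2) ^ 2 = 4 by norm_num]
  have h := hup _ hwin.1 hwin.2
  linarith [le_max_left βup 0]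

end UnitNumerals

/-! ## §3  `Provisos₁₂` fails at the witnesses of record under any level-0 β bound `β⁺ ≤ 165` -/

section Witness

variable (F : T4Family)
variable (ζ : ZetaOfRecord F 2 numerics7OfRecord₁₂ 1) (Rz : (K : ℕ) → Sect2.Residual (F.P K) (MatA 2))
  (Zt : (K : ℕ) → TkResidualW F 2 (FluctV 2) K)

/-- **★ AT `θ₀ = theta12OfRecord F 2 ζ Rz Zt`: a level-0 upper bound `β⁺ ≤ 165` of the merged β of record on `]0, ½]` (node00-def-K0a's ROW-W12
hypothesis `hup`, by which the K1′ window conjunct is made non-vacuous at the same `θ₀`) FORCES `¬ Provisos₁₂`.**  Run `p = ⟨1, m, (4 + max(β⁺,0))^{−1∕2}⟩`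
(K0a `inInterval_half_theta12OfRecord_of_level0Upper`), `g₀ ≥ 1∕13`, §2. [cite: Balaban1988Convergent, (2.27)–(2.28) p.259, (2.4) p.255; Balaban1987RG1, (0.17)–(0.20) pp.255–256, (1.14) p.262 (bookkeeping + elementary numerics)] -/
theorem not_provisos₁₂_theta12OfRecord_of_level0Upper {βup : ℝ} (hβ : βup ≤ 165)
    (hup : ∀ g : ℝ, 0 < g → g ≤ 1 / 2 →
      betaMerged F (mergedTermFamilyMatT F 2 (TcOfRecord F 2) (chiFixed7 F 2 numerics7OfRecord₁₂) 1)
        (suChartMap 2) (Pi.basisFun ℝ (Fin (suChartDim 2))) 0 (fun _ => g) ≤ βup) (m : ℕ) :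
    ¬ (theta12OfRecord F 2 ζ Rz Zt).Provisos₁₂ F 2 := by
  refine not_provisos₁₂_of_recordNumerals (theta12OfRecord F 2 ζ Rz Zt) rfl rfl rfl rfl rfl rfl rfl rfl
    ⟨1, m, solveCoupling (4 + max βup 0)⟩ le_rfl (inInterval_half_theta12OfRecord_of_level0Upper F 2 ζ Rz Zt hup m) ?_
  show 1 / 13 ≤ genSeq _ (solveCoupling (4 + max βup 0)) 0
  rw [genSeq_zero]; exact one_div_thirteen_le_solveCoupling hβ

/-- **★★ AT THE LIVE WITNESS `θ₀ˡⁱᵛᵉ = theta12LiveOfRecord F 2 ζ Rz Zt`** (the re-pinned K0′ witness of record, node00-def-K0a `Record12LiveSelector`):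
the same — the generated histories, the numerals and the Stage-8 part are selector-blind (`Stage12Params.gOfRecord₁₀_liveRepin`, `rfl`).
[cite: Balaban1988Convergent, (2.27)–(2.28) p.259; Balaban1989LargeFieldI, (0.3) p.176; Balaban1987RG1, (0.17)–(0.20) pp.255–256 (bookkeeping + elementary numerics)] -/
theorem not_provisos₁₂_theta12LiveOfRecord_of_level0Upper {βup : ℝ} (hβ : βup ≤ 165)
    (hup : ∀ g : ℝ, 0 < g → g ≤ 1 / 2 →
      betaMerged F (mergedTermFamilyMatT F 2 (TcOfRecord F 2) (chiFixed7 F 2 numerics7OfRecord₁₂) 1)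
        (suChartMap 2) (Pi.basisFun ℝ (Fin (suChartDim 2))) 0 (fun _ => g) ≤ βup) (m : ℕ) :
    ¬ (theta12LiveOfRecord F 2 ζ Rz Zt).Provisos₁₂ F 2 := by
  refine not_provisos₁₂_of_recordNumerals (theta12LiveOfRecord F 2 ζ Rz Zt) rfl rfl rfl rfl rfl rfl rfl rfl
    ⟨1, m, solveCoupling (4 + max βup 0)⟩ le_rfl (inInterval_half_theta12OfRecord_of_level0Upper F 2 ζ Rz Zt hup m) ?_
  show 1 / 13 ≤ genSeq _ (solveCoupling (4 + max βup 0)) 0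
  rw [genSeq_zero]; exact one_div_thirteen_le_solveCoupling hβ

end Witness

/-! ## §4  The same at the re-pinned witness OF THE FAMILY (every threshold letter `ε₀`) -/

section Family

variable (F : T4Family) (ε₀ : ℝ)
variable (ζ : ZetaOfRecord F 2 (numerics7OfFamily ε₀) 1) (Rz : (K : ℕ) → Sect2.Residual (F.P K) (MatA 2))
  (Zt : (K : ℕ) → TkResidualW F 2 (FluctV 2) K)

/-- **★ AT THE FAMILY WITNESS `θ₀ᶠᵃᵐ(ε₀) = theta12OfFamily F 2 ε₀ ζ Rz Zt`** (node00-def-K0a `Record12NumericsFamily`: `κ` re-pinned, `ε₀` an open letter —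
neither is read by the certificate): a level-0 upper bound `β⁺ ≤ 165` of the family's merged β on `]0, ½]` FORCES `¬ Provisos₁₂`, for EVERY `ε₀`.
[cite: Balaban1988Convergent, (2.27)–(2.28) p.259, (2.4) p.255; Balaban1987RG1, (0.17)–(0.20) pp.255–256, (1.14) p.262 (bookkeeping + elementary numerics)] -/
theorem not_provisos₁₂_theta12OfFamily_of_level0Upper {βup : ℝ} (hβ : βup ≤ 165)
    (hup : ∀ g : ℝ, 0 < g → g ≤ 1 / 2 →
      betaMerged F (mergedTermFamilyMatT F 2 (TcOfRecord F 2) (chiFixed7 F 2 (numerics7OfFamily ε₀)) 1)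
        (suChartMap 2) (Pi.basisFun ℝ (Fin (suChartDim 2))) 0 (fun _ => g) ≤ βup) (m : ℕ) :
    ¬ (theta12OfFamily F 2 ε₀ ζ Rz Zt).Provisos₁₂ F 2 := by
  refine not_provisos₁₂_of_recordNumerals (theta12OfFamily F 2 ε₀ ζ Rz Zt) rfl rfl rfl rfl rfl rfl rfl rfl
    ⟨1, m, solveCoupling (4 + max βup 0)⟩ le_rfl
    (inInterval_half_stage12OfNumerics_of_level0Upper (stage12NumericsOfFamily ε₀) rfl (residual5OfRecord₁₂ F 2) ζ Rz Zt hup m) ?_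
  show 1 / 13 ≤ genSeq _ (solveCoupling (4 + max βup 0)) 0
  rw [genSeq_zero]; exact one_div_thirteen_le_solveCoupling hβ

/-- **★★ AT THE LIVE FAMILY WITNESS `θ₀ᶠᵃᵐ,ˡⁱᵛᵉ(ε₀) = theta12LiveOfFamily F 2 ε₀ ζ Rz Zt`**: the same (selector-blind histories and numerals, `rfl`).
[cite: Balaban1988Convergent, (2.27)–(2.28) p.259; Balaban1989LargeFieldI, (0.3) p.176; Balaban1987RG1, (0.17)–(0.20) pp.255–256 (bookkeeping + elementary numerics)] -/
theorem not_provisos₁₂_theta12LiveOfFamily_of_level0Upper {βup : ℝ} (hβ : βup ≤ 165)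
    (hup : ∀ g : ℝ, 0 < g → g ≤ 1 / 2 →
      betaMerged F (mergedTermFamilyMatT F 2 (TcOfRecord F 2) (chiFixed7 F 2 (numerics7OfFamily ε₀)) 1)
        (suChartMap 2) (Pi.basisFun ℝ (Fin (suChartDim 2))) 0 (fun _ => g) ≤ βup) (m : ℕ) :
    ¬ (theta12LiveOfFamily F 2 ε₀ ζ Rz Zt).Provisos₁₂ F 2 := by
  refine not_provisos₁₂_of_recordNumerals (theta12LiveOfFamily F 2 ε₀ ζ Rz Zt) rfl rfl rfl rfl rfl rfl rfl rfl
    ⟨1, m, solveCoupling (4 + max βup 0)⟩ le_rfl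
    (inInterval_half_stage12OfNumerics_of_level0Upper (stage12NumericsOfFamily ε₀) rfl (residual5OfRecord₁₂ F 2) ζ Rz Zt hup m) ?_
  show 1 / 13 ≤ genSeq _ (solveCoupling (4 + max βup 0)) 0
  rw [genSeq_zero]; exact one_div_thirteen_le_solveCoupling hβ

end Family

end Summit.QuantumFields.YangMills.Theorems.K0BgProvisoOverRange

end
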